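import Summits.QuantumFields.YangMills.Theorems.PoincareLipschitzSphereMapOneStepFixedGeometryOuter

/-!
# Line «poincare_lipschitz» on crux `HistoryTailL` (stmt-QuantumFields-19936), route crux `BlockLipschitzL` (stmt-QuantumFields-23533), K2 organ of record LOC-REG-MIN —
# FLAT SHADOW «ENERGY → RANGE» (E→R) FOR LATTICE MINIMISERS INTO A SPHERE, FILE 5d-F1: THE ONE-STEP IMPROVEMENT FOR THE TENT MOLLIFIER —
# ✓`oneStep_fixedGeometry_outer` instantiated at the tent radius `Σ(y) = ⌊min(r′ − ‖y−z‖_∞, ‖y−z‖_∞ − (2R − r′))₊ ∕ 4⌋` of ✓F5d-D: all six radius hypotheses discharged;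
# what stays displayed is the near-sphere data (`‖c‖ ≥ ½`, `m`) and the band energy `E_U`, `U = Q_{r′−1}(z) ∖ Q_{2R−r′}(z)`

Cell `ym3-torus` (YM ladder rung R3 = continuum SU(2) Yang–Mills on the three-torus — a RUNG, NOT the Clay problem: not d = 4, not infinite volume, not a mass gap); width seat
`ym-ust-19936-w5` gen 12 (LEAD ym-ust-19936-w1 g8 2026-08-29T05:29:02Z END-GAME «[C] = E→R F5 (★w5) + F6 (px8)», 06:02:29Z «TWIST SLACK»; my LOCATE `E2R-ROAD-w5g12.md` §2).
THEOREMS ONLY (def-free), `V` finite-dimensional real inner-product space, lattice letters of lit ✓`B4Eq19LatticeOperators`; composes ★w5 g12's ✓F5d-E′ (slack form, outer near-sphere only) with ✓F5d-D's tent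
letters; `--supports stmt-QuantumFields-19936`.  Nothing here proves px8's `hone`, E→R, LOC-REG-MIN, `hReg`, `hImprove`, a stub, `BlockLipschitzL`, `HistoryTailL` or a summit statement.
* ★★★ `oneStep_tent` — for `d ≥ 1`, `1 ≤ R ≤ r′ ≤ r`, a unit field `u` ALMOST-minimising on `Q_r(z)` with slack `sl`, the tent-mollified field `c`, displayed `‖c‖ ≥ ½` OFF `Q_{R−1}` (outer slope + ring), `m ≤ ‖c‖` near the
  ring, `m ≤ 1 − (osc + η₀)` (`s = ⌊(r′−R)∕4⌋`), and `0 ≤ ρ ≤ R − 2`: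
  `E(u;Q_ρ) ≤ 2A_d((ρ+1)∕((R−2)+1))^d·E_R + 2·(sl + 4C₆·E_U + (m⁻²−1)·E_R + m⁻²·(2√(E_R·(2C₆+2)E_U) + (2C₆+2)E_U))`, `C₆ = d(2+4d)²d21^d·6^d`.
[folklore] ([SchoenUhlenbeck1982] §4; the lattice statement is this file's).
-/

set_option autoImplicit false

noncomputable section

open scoped BigOperators InnerProductSpace
open Finset

namespace Summit.QuantumFields.YangMills.Theorems.PoincareLipschitzSphereMapTentOneStep

open Literature.MathematicalPhysics.QuantumFieldTheory.Balaban1983to89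
open B4Eq19LatticeOperators
open Summit.QuantumFields.YangMills.Theorems.PoincareLipschitzSphereMapOneStepFixedGeometryOuter (oneStep_fixedGeometry_outer)
open Summit.QuantumFields.YangMills.Theorems.PoincareLipschitzSphereMapTentSupport
  (tentRadius_nonneg abs_tentRadius_sub_le_one tentRadius_comparable tentRadius_pos_band tentRadius_ring box_tent_subset_band)

variable {d : ℕ} {V : Type*} [NormedAddCommGroup V] [InnerProductSpace ℝ V]

/-- ★★★ **THE ONE-STEP IMPROVEMENT FOR THE TENT MOLLIFIER** (✓`oneStep_fixedGeometry_outer` at the tent radius of ✓F5d-D; `R_in = 2R − r′`, `s = ⌊(r′ − R)∕4⌋`,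
comparability constants `A = 2`, `B = 3`, so `(A+B+1)^d = 6^d`).  Displayed: unit `u` ALMOST-minimising on `Q_r(z)` (slack `sl`), the tent-mollified field `c`, `‖c‖ ≥ ½`,
`m ≤ ‖c‖` on `Q_{R+1}∖Q_{R−1}`, `0 < m ≤ 1`, `m ≤ 1 − (2dR√((2s+1)^{−d}E′) + 2(2s+1)√(d(2s+1)^{−d}E′))`, `E′ = E(u;Q_{R+s+1})`. [folklore]
[cite: SchoenUhlenbeck1982, §4] -/
theorem oneStep_tent [FiniteDimensional ℝ V] (hd : 0 < d) (u c : Zd d → V) (z : Zd d) {r r' R : ℤ}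
    (hu : ∀ y, ‖u y‖ = 1)
    (hc : ∀ y, c y = (((box y ((((min (r' - ((Finset.univ.sup fun j => (y j - z j).natAbs : ℕ) : ℤ))
        (((Finset.univ.sup fun j => (y j - z j).natAbs : ℕ) : ℤ) - (2 * R - r'))).toNat / 4 : ℕ) : ℤ))).card : ℝ))⁻¹ •
      ∑ w ∈ box y ((((min (r' - ((Finset.univ.sup fun j => (y j - z j).natAbs : ℕ) : ℤ))
        (((Finset.univ.sup fun j => (y j - z j).natAbs : ℕ) : ℤ) - (2 * R - r'))).toNat / 4 : ℕ) : ℤ)), u w)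
    (hR1 : 1 ≤ R) (hRr' : R ≤ r') (hr'r : r' ≤ r)
    {sl : ℝ} (hminU : ∀ w : Zd d → V, (∀ y, ‖w y‖ = 1) → (∀ y ∉ box z (r - 1), w y = u y) →
      ∑ y ∈ box z r, ∑ μ, ‖u (y + unitVec μ) - u y‖ ^ 2 ≤ ∑ y ∈ box z r, ∑ μ, ‖w (y + unitVec μ) - w y‖ ^ 2 + sl)
    (hhalf : ∀ y ∉ box z (R - 1), (1 / 2 : ℝ) ≤ ‖c y‖) {m : ℝ} (hm : 0 < m) (hm1 : m ≤ 1)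
    (hmc : ∀ y ∈ box z (R + 1), y ∉ box z (R - 1) → m ≤ ‖c y‖)
    (hmH : m ≤ 1 - (2 * d * R * Real.sqrt (((((2 * (((r' - R).toNat / 4 : ℕ) : ℤ) + 1 : ℤ) : ℝ) ^ d))⁻¹ *
          ∑ w ∈ box z (R + (((r' - R).toNat / 4 : ℕ) : ℤ) + 1), ∑ μ, ‖u (w + unitVec μ) - u w‖ ^ 2) +
        2 * ((2 * (((r' - R).toNat / 4 : ℕ) : ℤ) + 1 : ℤ) : ℝ) * Real.sqrt (d * ((((2 * (((r' - R).toNat / 4 : ℕ) : ℤ) + 1 : ℤ) : ℝ) ^ d))⁻¹ *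
          ∑ w ∈ box z (R + (((r' - R).toNat / 4 : ℕ) : ℤ) + 1), ∑ μ, ‖u (w + unitVec μ) - u w‖ ^ 2)))
    {ρ : ℤ} (hρ : 0 ≤ ρ) (hρR : ρ ≤ R - 2) :
    ∑ y ∈ box z ρ, ∑ μ, ‖u (y + unitVec μ) - u y‖ ^ 2 ≤
      2 * ((2 : ℝ) ^ d * (1 + 56 * d) ^ d * (8 * ((d : ℝ) + 1)) ^ (d + 1) * (((ρ : ℝ) + 1) / (((R - 2 : ℤ) : ℝ) + 1)) ^ d) *
          ∑ y ∈ box z R, ∑ μ, ‖u (y + unitVec μ) - u y‖ ^ 2 +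
        2 * (sl + 4 * ((d : ℝ) * ((2 + 4 * (d : ℝ)) ^ 2 * d * (21 : ℝ) ^ d) * (((2 : ℕ) : ℝ) + (3 : ℕ) + 1) ^ d) *
              ∑ y ∈ box z (r' - 1) \ box z (2 * R - r'), ∑ μ, ‖u (y + unitVec μ) - u y‖ ^ 2 +
          ((m ^ 2)⁻¹ - 1) * ∑ y ∈ box z R, ∑ μ, ‖u (y + unitVec μ) - u y‖ ^ 2 +
          (m ^ 2)⁻¹ * (2 * Real.sqrt ((∑ y ∈ box z R, ∑ μ, ‖u (y + unitVec μ) - u y‖ ^ 2) *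
              ((2 * ((d : ℝ) * ((2 + 4 * (d : ℝ)) ^ 2 * d * (21 : ℝ) ^ d) * (((2 : ℕ) : ℝ) + (3 : ℕ) + 1) ^ d) + 2) *
                ∑ y ∈ box z (r' - 1) \ box z (2 * R - r'), ∑ μ, ‖u (y + unitVec μ) - u y‖ ^ 2)) +
            (2 * ((d : ℝ) * ((2 + 4 * (d : ℝ)) ^ 2 * d * (21 : ℝ) ^ d) * (((2 : ℕ) : ℝ) + (3 : ℕ) + 1) ^ d) + 2) *
              ∑ y ∈ box z (r' - 1) \ box z (2 * R - r'), ∑ μ, ‖u (y + unitVec μ) - u y‖ ^ 2)) := by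
  set Rin : ℤ := 2 * R - r' with hRin
  set σ : Zd d → ℤ := fun y => (((min (r' - ((Finset.univ.sup fun j => (y j - z j).natAbs : ℕ) : ℤ))
        (((Finset.univ.sup fun j => (y j - z j).natAbs : ℕ) : ℤ) - Rin)).toNat / 4 : ℕ) : ℤ) with hσ
  have hc' : ∀ y, c y = (((box y (σ y)).card : ℝ))⁻¹ • ∑ w ∈ box y (σ y), u w := fun y => hc y
  have hσ0 : ∀ y, 0 ≤ σ y := fun y => tentRadius_nonneg z r' Rin y
  have hσL : ∀ y, ∀ μ : Fin d, |σ (y + unitVec μ) - σ y| ≤ 1 := fun y μ => abs_tentRadius_sub_le_one hd z r' Rin y μ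
  have hσC : ∀ x x' y : Zd d, y ∈ box x (σ x + 2) → y ∈ box x' (σ x' + 2) → σ x ≤ ((2 : ℕ) : ℤ) * σ x' + (3 : ℕ) := by
    intro x x' y h1 h2
    have := tentRadius_comparable hd z r' Rin x x' y h1 h2
    push_cast at this ⊢
    exact this
  have hσband : ∀ y, σ y ≠ 0 → Rin + 4 ≤ ((Finset.univ.sup fun j => (y j - z j).natAbs : ℕ) : ℤ) ∧
      ((Finset.univ.sup fun j => (y j - z j).natAbs : ℕ) : ℤ) ≤ r' - 4 := fun y hy => tentRadius_pos_band z r' Rin y hy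
  have hσbox : ∀ y, Rin + 3 ≤ ((Finset.univ.sup fun j => (y j - z j).natAbs : ℕ) : ℤ) → ((Finset.univ.sup fun j => (y j - z j).natAbs : ℕ) : ℤ) ≤ r' - 3 →
      box y (σ y + 2) ⊆ box z (r' - 1) \ box z Rin := fun y h1 h2 => box_tent_subset_band hd z r' Rin y h1 h2
  have hσring : ∀ y, ((Finset.univ.sup fun j => (y j - z j).natAbs : ℕ) : ℤ) = R → σ y = (((r' - R).toNat / 4 : ℕ) : ℤ) := by
    intro y hy
    have := tentRadius_ring z r' R y hy
    simp only [hσ, hRin]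
    exact this
  have hs : (0 : ℤ) ≤ (((r' - R).toNat / 4 : ℕ) : ℤ) := by exact_mod_cast Nat.zero_le _
  exact oneStep_fixedGeometry_outer hd u c σ z hu hc' hσ0 hσL (A := 2) (B := 3) (by norm_num) hσC hσband hσbox hσring hs hR1 hRr' hr'r
    hminU hhalf hm hm1 hmc hmH hρ hρR

end Summit.QuantumFields.YangMills.Theorems.PoincareLipschitzSphereMapTentOneStep
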